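import Mathlib.Analysis.SpecialFunctions.Pow.Real
import Mathlib.Analysis.SpecialFunctions.Sqrt
import Mathlib.Algebra.BigOperators.Fin
import Mathlib.Tactic.LinearCombination

/-!
# Type-I audit of the linear forcing coefficients (level-independent, pure real algebra)

Helper file for the line `log-lipschitz-budget` of the crux `ImplosionDichotomy.PolynomialCompression`
(stmt-AtomisticToContinuum-12587), stub `stub_logBudgetShadowing` (level-3 estimate, top-order part).
The part of the forcing `f = -(P_V - P_{V₁})V₁` of the difference system that is LINEAR in
`δV = (δρ, δu, δθ)` has reference-gradient coefficients: `f_ρ ∋ -δρ div u₁ - δu·∇ρ₁`,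
`f_uⱼ ∋ -(δu·∇)u₁ⱼ - (δθ γ/ρ) ∂ⱼρ₁ + (θ₁ δρ/(ρ ρ₁)) ∂ⱼρ₁`, `f_θ ∋ -δu·∇θ₁ - (2/3) ζ δθ div u₁`. After
`k` derivatives the top-order term is the same expression with `δV` replaced by `∂^α δV =: (a, w, b)`;
paired with `(A a, ρ w, B b)` it is `≤ (Λ/λ) · ½(A a² + ρ|w|² + B b²)` because every coefficient is
Type I after weighting (isentropic reference: `ρ₁ = c₁³`, `θ₁ = K c₁²`, `∂ρ₁ = 3c₁² ∂c₁`,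
`∂θ₁ = 2Kc₁ ∂c₁`, `|∂u₁|, |∂c₁| ≤ C/λ`). Point dictionary as in `QuadraticPointwise`/`PairingPointwise`.

The proof: the two diagonal terms `-A a² div u₁`, `-(2/3) ζ0 B b² div u₁` are Type I as they stand;
the convective term `-ρ Σ wⱼ wᵢ ∂ᵢu₁ⱼ` is Type I entrywise; the `a–w` cross terms combine to
`3c₁ (K - c₁ A) dcᵢ · a wᵢ` and the `b–w` cross terms to `-(3c₁² γ + 2Kc₁ B) dcᵢ · b wᵢ`, both of
which are absorbed by AM–GM because the Type-I sizes of the coefficients are matched by the weights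
(`A ρ ≈ K c₁²`, `B K c₁² ≈ ρ ≈ c₁³`).  We take `Λ = C (95 + 78 K)`.
-/

namespace Summit.AtomisticToContinuum.HydrodynamicLimit.Theorems

open Finset

/-! ### Elementary absorption lemmas (adapted from `…PairingPointwise`) -/

-- adapted from Summits/…/ImplosionDichotomyPolynomialCompressionPairingPointwise.lean
/-- AM–GM absorption of a cross term `κ x y` into `L · ½ (P x² + Q y²)` when `κ² ≤ L² P Q`.
[folklore] -/
private lemma fa_cross_le {P Q L κ x y : ℝ} (hP : 0 < P) (hL : 0 ≤ L)
    (hκ : κ ^ 2 ≤ L ^ 2 * P * Q) : κ * x * y ≤ L * (1 / 2 * (P * x ^ 2 + Q * y ^ 2)) := by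
  rcases hL.eq_or_lt with hL0 | hLpos
  · have hκ0 : κ = 0 := by
      rw [← hL0] at hκ
      nlinarith [sq_nonneg κ]
    simp [hκ0, ← hL0]
  · have key : 0 ≤ (L * P * x - κ * y) ^ 2 + (L ^ 2 * P * Q - κ ^ 2) * y ^ 2 := by
      linarith [sq_nonneg (L * P * x - κ * y), mul_nonneg (sub_nonneg.2 hκ) (sq_nonneg y)]
    have hLP : 0 < L * P := mul_pos hLpos hP
    have hid : (L * P) * (2 * (L * (1 / 2 * (P * x ^ 2 + Q * y ^ 2)) - κ * x * y))
        = (L * P * x - κ * y) ^ 2 + (L ^ 2 * P * Q - κ ^ 2) * y ^ 2 := by ring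
    have h3 : 0 ≤ 2 * (L * (1 / 2 * (P * x ^ 2 + Q * y ^ 2)) - κ * x * y) := by
      refine (mul_nonneg_iff_of_pos_left hLP).1 ?_
      rw [hid]; exact key
    linarith

-- adapted from Summits/…/ImplosionDichotomyPolynomialCompressionPairingPointwise.lean
/-- Sum of three cross terms `κᵢ x yᵢ` absorbed by the energy `E ≥ ½ (P x² + Q Σ yᵢ²)`.
[folklore] -/
private lemma fa_cross_sum_le {P Q L E x : ℝ} {κ y : Fin 3 → ℝ} (hP : 0 < P) (hQ : 0 < Q)
    (hL : 0 ≤ L) (hκ : ∀ i, κ i ^ 2 ≤ L ^ 2 * P * Q) (hEx : P * x ^ 2 ≤ 2 * E)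
    (hExy : P * x ^ 2 + Q * (y 0 ^ 2 + y 1 ^ 2 + y 2 ^ 2) ≤ 2 * E) :
    κ 0 * x * y 0 + κ 1 * x * y 1 + κ 2 * x * y 2 ≤ 3 * L * E := by
  have h0 := fa_cross_le (x := x) (y := y 0) hP hL (hκ 0)
  have h1 := fa_cross_le (x := x) (y := y 1) hP hL (hκ 1)
  have h2 := fa_cross_le (x := x) (y := y 2) hP hL (hκ 2)
  have hQ' : 0 ≤ Q * (y 0 ^ 2 + y 1 ^ 2 + y 2 ^ 2) := by positivity
  have hsum : 1 / 2 * (P * x ^ 2 + Q * y 0 ^ 2) + 1 / 2 * (P * x ^ 2 + Q * y 1 ^ 2)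
      + 1 / 2 * (P * x ^ 2 + Q * y 2 ^ 2) ≤ 3 * E := by linarith
  have h3 := mul_le_mul_of_nonneg_left hsum hL
  linarith

-- adapted from Summits/…/ImplosionDichotomyPolynomialCompressionPairingPointwise.lean
/-- Type-I bound of a pure quadratic term: `-(P S) ≤ L P` for `P ≥ 0`, `|S| ≤ L`. [folklore] -/
private lemma fa_quad_le {P S L : ℝ} (hP : 0 ≤ P) (hS : |S| ≤ L) : -(P * S) ≤ L * P := by
  have h1 : -S ≤ L := (neg_le_abs S).trans hS
  nlinarith [mul_le_mul_of_nonneg_left h1 hP]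

-- adapted from Summits/…/ImplosionDichotomyPolynomialCompressionPairingPointwise.lean
/-- One entry of the convective bilinear term: `-(x y d) ≤ ε (x² + y²)/2` for `|d| ≤ ε`.
[folklore] -/
private lemma fa_pair_le {ε x y d : ℝ} (hd : |d| ≤ ε) :
    -(x * (y * d)) ≤ ε * ((x ^ 2 + y ^ 2) / 2) := by
  obtain ⟨h1, h2⟩ := abs_le.1 hd
  nlinarith [mul_nonneg (sub_nonneg.2 h2) (sq_nonneg (x + y)),
    mul_nonneg (show (0 : ℝ) ≤ ε + d by linarith) (sq_nonneg (x - y))]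

-- adapted from Summits/…/ImplosionDichotomyPolynomialCompressionPairingPointwise.lean
/-- The convective term `-ρ Σⱼ wⱼ Σᵢ wᵢ ∂ᵢu₁ⱼ` is Type I: `≤ 6 ε E`. [folklore] -/
private lemma fa_convective_le {ρ ε E : ℝ} {w : Fin 3 → ℝ} {du : Fin 3 → Fin 3 → ℝ}
    (hρ : 0 ≤ ρ) (hdu : ∀ i j, |du i j| ≤ ε)
    (hEw : ρ * (w 0 ^ 2 + w 1 ^ 2 + w 2 ^ 2) ≤ 2 * E) :
    -(ρ * (w 0 * (w 0 * du 0 0 + w 1 * du 1 0 + w 2 * du 2 0)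
        + w 1 * (w 0 * du 0 1 + w 1 * du 1 1 + w 2 * du 2 1)
        + w 2 * (w 0 * du 0 2 + w 1 * du 1 2 + w 2 * du 2 2))) ≤ 6 * ε * E := by
  have h00 := fa_pair_le (x := w 0) (y := w 0) (hdu 0 0)
  have h10 := fa_pair_le (x := w 0) (y := w 1) (hdu 1 0)
  have h20 := fa_pair_le (x := w 0) (y := w 2) (hdu 2 0)
  have h01 := fa_pair_le (x := w 1) (y := w 0) (hdu 0 1)
  have h11 := fa_pair_le (x := w 1) (y := w 1) (hdu 1 1)
  have h21 := fa_pair_le (x := w 1) (y := w 2) (hdu 2 1)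
  have h02 := fa_pair_le (x := w 2) (y := w 0) (hdu 0 2)
  have h12 := fa_pair_le (x := w 2) (y := w 1) (hdu 1 2)
  have h22 := fa_pair_le (x := w 2) (y := w 2) (hdu 2 2)
  have hsum : -(w 0 * (w 0 * du 0 0 + w 1 * du 1 0 + w 2 * du 2 0)
        + w 1 * (w 0 * du 0 1 + w 1 * du 1 1 + w 2 * du 2 1)
        + w 2 * (w 0 * du 0 2 + w 1 * du 1 2 + w 2 * du 2 2))
      ≤ 3 * ε * (w 0 ^ 2 + w 1 ^ 2 + w 2 ^ 2) := by
    linarith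
  have hε : 0 ≤ ε := (abs_nonneg _).trans (hdu 0 0)
  have h1 := mul_le_mul_of_nonneg_left hsum hρ
  have h2 := mul_le_mul_of_nonneg_left hEw (by positivity : (0 : ℝ) ≤ 3 * ε)
  linarith

-- adapted from Summits/…/ImplosionDichotomyPolynomialCompressionPairingPointwise.lean
/-- The `a–w` cross terms `3c₁ (K − c₁A) dcᵢ · a wᵢ`: Type I. [folklore] -/
private lemma fa_crossA_le {K ε c₁ ρ A E a : ℝ} {dc w : Fin 3 → ℝ} (hK : 0 < K) (hε : 0 ≤ ε)
    (hc₁ : 0 < c₁) (hρlo : c₁ ^ 3 / 2 ≤ ρ) (hApos : 0 < A) (hAc : A * c₁ ≤ 15 * K / 4)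
    (hAρlo : 3 * (K * c₁ ^ 2) / 8 ≤ A * ρ) (hdc2 : ∀ i, dc i ^ 2 ≤ ε ^ 2)
    (hEa : A * a ^ 2 ≤ 2 * E) (hEaw : A * a ^ 2 + ρ * (w 0 ^ 2 + w 1 ^ 2 + w 2 ^ 2) ≤ 2 * E) :
    3 * c₁ * (K - c₁ * A) * dc 0 * a * w 0 + 3 * c₁ * (K - c₁ * A) * dc 1 * a * w 1
      + 3 * c₁ * (K - c₁ * A) * dc 2 * a * w 2 ≤ 42 * (K + 1) * ε * E := by
  have hρ : 0 < ρ := lt_of_lt_of_le (by positivity) hρlo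
  have hsq : (K - c₁ * A) ^ 2 ≤ 2 * K ^ 2 + 2 * (c₁ * A) ^ 2 := by
    nlinarith [sq_nonneg (K + c₁ * A)]
  have h83 : K * c₁ ^ 2 ≤ 8 / 3 * (A * ρ) := by linarith
  have h2ρ : c₁ ^ 3 ≤ 2 * ρ := by linarith
  have hκ : ∀ i, (3 * c₁ * (K - c₁ * A) * dc i) ^ 2 ≤ (14 * (K + 1) * ε) ^ 2 * A * ρ := by
    intro i
    have hd := hdc2 i
    calc (3 * c₁ * (K - c₁ * A) * dc i) ^ 2 = 9 * c₁ ^ 2 * (K - c₁ * A) ^ 2 * dc i ^ 2 := by ring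
      _ ≤ 9 * c₁ ^ 2 * (2 * K ^ 2 + 2 * (c₁ * A) ^ 2) * ε ^ 2 := by gcongr
      _ = 18 * K * (K * c₁ ^ 2) * ε ^ 2 + 18 * c₁ ^ 3 * A * (A * c₁) * ε ^ 2 := by ring
      _ ≤ 18 * K * (8 / 3 * (A * ρ)) * ε ^ 2 + 18 * (2 * ρ) * A * (15 * K / 4) * ε ^ 2 := by
          gcongr
      _ ≤ (14 * (K + 1) * ε) ^ 2 * A * ρ := by
          have : 0 ≤ ε ^ 2 * A * ρ * (196 * K ^ 2 + 209 * K + 196) := by positivity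
          linarith
  have h := fa_cross_sum_le (κ := fun i => 3 * c₁ * (K - c₁ * A) * dc i) hApos hρ
    (by positivity) hκ hEa hEaw
  linarith

-- adapted from Summits/…/ImplosionDichotomyPolynomialCompressionPairingPointwise.lean
/-- The `b–w` cross terms `−(3c₁²γ + 2Kc₁B) dcᵢ · b wᵢ`: Type I. [folklore] -/
private lemma fa_crossB_le {K ε c₁ ρ γ B E b : ℝ} {dc w : Fin 3 → ℝ} (hK : 0 < K) (hε : 0 ≤ ε)
    (hc₁ : 0 < c₁) (hρlo : c₁ ^ 3 / 2 ≤ ρ) (hBpos : 0 < B) (hBK1 : ρ ≤ B * (K * c₁ ^ 2))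
    (hBK2 : B * (K * c₁ ^ 2) ≤ 3 * ρ) (hγ : 0 ≤ γ) (hγhi : γ ≤ 5 / 4)
    (hdc2 : ∀ i, dc i ^ 2 ≤ ε ^ 2) (hEb : B * b ^ 2 ≤ 2 * E)
    (hEbw : B * b ^ 2 + ρ * (w 0 ^ 2 + w 1 ^ 2 + w 2 ^ 2) ≤ 2 * E) :
    -((3 * c₁ ^ 2 * γ + 2 * K * c₁ * B) * dc 0) * b * w 0
      + -((3 * c₁ ^ 2 * γ + 2 * K * c₁ * B) * dc 1) * b * w 1
      + -((3 * c₁ ^ 2 * γ + 2 * K * c₁ * B) * dc 2) * b * w 2 ≤ 36 * (K + 1) * ε * E := by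
  have hρ : 0 < ρ := lt_of_lt_of_le (by positivity) hρlo
  have hKc : 0 < K * c₁ ^ 2 := by positivity
  have hsq : (3 * c₁ ^ 2 * γ + 2 * K * c₁ * B) ^ 2
      ≤ 2 * (3 * c₁ ^ 2 * γ) ^ 2 + 2 * (2 * K * c₁ * B) ^ 2 := by
    nlinarith [sq_nonneg (3 * c₁ ^ 2 * γ - 2 * K * c₁ * B)]
  have h2ρ : c₁ ^ 3 ≤ 2 * ρ := by linarith
  have h6 : c₁ ^ 3 * c₁ ^ 3 ≤ (2 * ρ) * (2 * ρ) := by gcongr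
  have hγ2 : γ ^ 2 ≤ (5 / 4) ^ 2 := by gcongr
  have hκ : ∀ i, (-((3 * c₁ ^ 2 * γ + 2 * K * c₁ * B) * dc i)) ^ 2
      ≤ (12 * (K + 1) * ε) ^ 2 * B * ρ := by
    intro i
    have hd := hdc2 i
    refine le_of_mul_le_mul_right ?_ hKc
    calc (-((3 * c₁ ^ 2 * γ + 2 * K * c₁ * B) * dc i)) ^ 2 * (K * c₁ ^ 2)
        = (3 * c₁ ^ 2 * γ + 2 * K * c₁ * B) ^ 2 * dc i ^ 2 * (K * c₁ ^ 2) := by ring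
      _ ≤ (2 * (3 * c₁ ^ 2 * γ) ^ 2 + 2 * (2 * K * c₁ * B) ^ 2) * ε ^ 2 * (K * c₁ ^ 2) := by
          gcongr
      _ = 18 * K * γ ^ 2 * ε ^ 2 * (c₁ ^ 3 * c₁ ^ 3)
          + 8 * K ^ 2 * ε ^ 2 * c₁ ^ 2 * B * (B * (K * c₁ ^ 2)) := by ring
      _ ≤ 18 * K * (5 / 4) ^ 2 * ε ^ 2 * ((2 * ρ) * (2 * ρ))
          + 8 * K ^ 2 * ε ^ 2 * c₁ ^ 2 * B * (3 * ρ) := by gcongr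
      _ = 72 * K * (5 / 4) ^ 2 * ε ^ 2 * ρ * ρ + 24 * K ^ 2 * ε ^ 2 * c₁ ^ 2 * B * ρ := by ring
      _ ≤ 72 * K * (5 / 4) ^ 2 * ε ^ 2 * ρ * (B * (K * c₁ ^ 2))
          + 24 * K ^ 2 * ε ^ 2 * c₁ ^ 2 * B * ρ := by gcongr
      _ ≤ (12 * (K + 1) * ε) ^ 2 * B * ρ * (K * c₁ ^ 2) := by
          have : 0 ≤ K * c₁ ^ 2 * ε ^ 2 * B * ρ * (288 * K ^ 2 + 303 * K + 288) := by
            positivity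
          linarith
  have h := fa_cross_sum_le (κ := fun i => -((3 * c₁ ^ 2 * γ + 2 * K * c₁ * B) * dc i)) hBpos hρ
    (by positivity) hκ hEb hEbw
  linarith

/-! ### The algebraic core -/

/-- The linear forcing pairing with the algebra done, in terms of the weights `A = θ(ζ0+ζ1)/ρ`,
`B = 3ρ/(2θ)`, the energy `E = ½ (A a² + ρ Σ wᵢ² + B b²)` and the derivative scale `ε = C/λ`:
it is at most `(95 + 78 K) ε E`. [folklore] -/
private theorem fa_main_bound (K ε c₁ ρ θ ζ0 ζ1 a b A B E : ℝ)
    (du : Fin 3 → Fin 3 → ℝ) (dc : Fin 3 → ℝ) (w : Fin 3 → ℝ)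
    (hK : 0 < K) (hε : 0 ≤ ε) (hc₁ : 0 < c₁)
    (hζ0 : |ζ0 - 1| ≤ 1 / 8) (hζ1 : |ζ1| ≤ 1 / 8)
    (hρb : |ρ - c₁ ^ 3| ≤ c₁ ^ 3 / 2) (hθb : |θ - K * c₁ ^ 2| ≤ K * c₁ ^ 2 / 2)
    (hdu : ∀ i j, |du i j| ≤ ε) (hdc : ∀ i, |dc i| ≤ ε)
    (hA : A = θ * (ζ0 + ζ1) / ρ) (hB : B = 3 / 2 * ρ / θ)
    (hE : E = 1 / 2 * (A * a ^ 2 + ρ * (w 0 ^ 2 + w 1 ^ 2 + w 2 ^ 2) + B * b ^ 2)) :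
    -(A * a ^ 2 * (du 0 0 + du 1 1 + du 2 2))
      + (3 * c₁ * (K - c₁ * A) * dc 0 * a * w 0 + 3 * c₁ * (K - c₁ * A) * dc 1 * a * w 1
          + 3 * c₁ * (K - c₁ * A) * dc 2 * a * w 2)
      - ρ * (w 0 * (w 0 * du 0 0 + w 1 * du 1 0 + w 2 * du 2 0)
          + w 1 * (w 0 * du 0 1 + w 1 * du 1 1 + w 2 * du 2 1)
          + w 2 * (w 0 * du 0 2 + w 1 * du 1 2 + w 2 * du 2 2))
      + (-((3 * c₁ ^ 2 * (ζ0 + ζ1) + 2 * K * c₁ * B) * dc 0) * b * w 0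
          + -((3 * c₁ ^ 2 * (ζ0 + ζ1) + 2 * K * c₁ * B) * dc 1) * b * w 1
          + -((3 * c₁ ^ 2 * (ζ0 + ζ1) + 2 * K * c₁ * B) * dc 2) * b * w 2)
      - 2 / 3 * ζ0 * B * b ^ 2 * (du 0 0 + du 1 1 + du 2 2)
      ≤ (95 + 78 * K) * ε * E := by
  obtain ⟨hr1, hr2⟩ := abs_le.1 hρb
  obtain ⟨ht1, ht2⟩ := abs_le.1 hθb
  obtain ⟨hz1, hz2⟩ := abs_le.1 hζ0
  obtain ⟨hy1, hy2⟩ := abs_le.1 hζ1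
  have hc2 : 0 < c₁ ^ 2 := by positivity
  have hc3 : 0 < c₁ ^ 3 := by positivity
  have hKc : 0 < K * c₁ ^ 2 := by positivity
  have hρlo : c₁ ^ 3 / 2 ≤ ρ := by linarith
  have hθlo : K * c₁ ^ 2 / 2 ≤ θ := by linarith
  have hθhi : θ ≤ 3 * (K * c₁ ^ 2) / 2 := by linarith
  have hρ : 0 < ρ := by linarith
  have hθ : 0 < θ := by linarith
  have hγlo : 3 / 4 ≤ ζ0 + ζ1 := by linarith
  have hγhi : ζ0 + ζ1 ≤ 5 / 4 := by linarith
  have hγ : 0 < ζ0 + ζ1 := by linarith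
  have hz0 : 0 ≤ ζ0 := by linarith
  have hApos : 0 < A := by rw [hA]; positivity
  have hBpos : 0 < B := by rw [hB]; positivity
  have hAρ : A * ρ = θ * (ζ0 + ζ1) := by rw [hA]; field_simp
  have hBθ : B * θ = 3 / 2 * ρ := by rw [hB]; field_simp
  have hAρlo : 3 * (K * c₁ ^ 2) / 8 ≤ A * ρ := by
    have := mul_le_mul hθlo hγlo (by norm_num) hθ.le
    rw [hAρ]; linarith
  have hAc : A * c₁ ≤ 15 * K / 4 := by
    have h0 := mul_le_mul hθhi hγhi hγ.le (by positivity)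
    have h1 : A * (c₁ ^ 3 / 2) ≤ A * ρ := mul_le_mul_of_nonneg_left hρlo hApos.le
    have h2 : A * c₁ * c₁ ^ 2 ≤ 15 * K / 4 * c₁ ^ 2 := by rw [hAρ] at h1; linarith
    exact le_of_mul_le_mul_right h2 hc2
  have hBK1 : ρ ≤ B * (K * c₁ ^ 2) := by
    have := mul_le_mul_of_nonneg_left hθhi hBpos.le
    linarith
  have hBK2 : B * (K * c₁ ^ 2) ≤ 3 * ρ := by
    have := mul_le_mul_of_nonneg_left hθlo hBpos.le
    linarith
  have pa : 0 ≤ A * a ^ 2 := by positivity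
  have pw0 : 0 ≤ ρ * w 0 ^ 2 := by positivity
  have pw1 : 0 ≤ ρ * w 1 ^ 2 := by positivity
  have pw2 : 0 ≤ ρ * w 2 ^ 2 := by positivity
  have pb : 0 ≤ B * b ^ 2 := by positivity
  have hE0 : 0 ≤ E := by rw [hE]; linarith
  have hEa : A * a ^ 2 ≤ 2 * E := by rw [hE]; linarith
  have hEb : B * b ^ 2 ≤ 2 * E := by rw [hE]; linarith
  have hEaw : A * a ^ 2 + ρ * (w 0 ^ 2 + w 1 ^ 2 + w 2 ^ 2) ≤ 2 * E := by rw [hE]; linarith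
  have hEbw : B * b ^ 2 + ρ * (w 0 ^ 2 + w 1 ^ 2 + w 2 ^ 2) ≤ 2 * E := by rw [hE]; linarith
  have hEws : ρ * (w 0 ^ 2 + w 1 ^ 2 + w 2 ^ 2) ≤ 2 * E := by rw [hE]; linarith
  have hdc2 : ∀ i, dc i ^ 2 ≤ ε ^ 2 := fun i => by
    have h := abs_le.1 (hdc i); exact sq_le_sq' h.1 h.2
  have hSabs : |du 0 0 + du 1 1 + du 2 2| ≤ 3 * ε := by
    calc |du 0 0 + du 1 1 + du 2 2| ≤ |du 0 0| + |du 1 1| + |du 2 2| := abs_add_three _ _ _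
      _ ≤ ε + ε + ε := by gcongr <;> exact hdu _ _
      _ = 3 * ε := by ring
  have hT1 : -(A * a ^ 2 * (du 0 0 + du 1 1 + du 2 2)) ≤ 6 * ε * E := by
    linarith [fa_quad_le pa hSabs,
      mul_le_mul_of_nonneg_left hEa (by positivity : (0 : ℝ) ≤ 3 * ε)]
  have hT2 : -(2 / 3 * ζ0 * B * b ^ 2 * (du 0 0 + du 1 1 + du 2 2)) ≤ 5 * ε * E := by
    have h1 := fa_quad_le (P := 2 / 3 * ζ0 * B * b ^ 2) (by positivity) hSabs
    have h2 : ζ0 * (ε * (B * b ^ 2)) ≤ 9 / 8 * (ε * (B * b ^ 2)) :=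
      mul_le_mul_of_nonneg_right (by linarith) (by positivity)
    have h3 := mul_le_mul_of_nonneg_left hEb (by positivity : (0 : ℝ) ≤ 9 / 4 * ε)
    linarith [mul_nonneg hε hE0]
  have hT3 := fa_convective_le (E := E) hρ.le hdu hEws
  have hT4 := fa_crossA_le (a := a) hK hε hc₁ hρlo hApos hAc hAρlo hdc2 hEa hEaw
  have hT5 := fa_crossB_le (b := b) hK hε hc₁ hρlo hBpos hBK1 hBK2 hγ.le hγhi hdc2 hEb hEbw
  linarith [mul_nonneg hε hE0]

/-- **Type-I bound of the linear forcing pairing, generic top jet.** Given `K > 0`, `C, cZ ≥ 0` there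
is `Λ ≥ 0` such that at every point of the bootstrap regime (`ρ, θ` within half of `c₁³, K c₁²`, law
values `|ζ0 - 1|, |ζ1| ≤ cZ ηh`, `ηh (cZ + 1) ≤ 1/8`, reference gradients `|du₁ i j|, |dc₁ i| ≤ C/λ`) and
for ARBITRARY numbers `a, b, wⱼ` (the top jet):
`A a (-(a Σᵢ du₁ᵢᵢ) - Σᵢ wᵢ 3c₁² dc₁ᵢ) + ρ Σⱼ wⱼ (-(Σᵢ wᵢ du₁ᵢⱼ) - (b (ζ0+ζ1)/ρ) 3c₁² dc₁ⱼ + (K c₁² a/(ρ c₁³)) 3c₁² dc₁ⱼ)`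
`+ B b (-(Σᵢ wᵢ 2Kc₁ dc₁ᵢ) - (2/3) ζ0 b Σᵢ du₁ᵢᵢ) ≤ (Λ/λ) · ½(A a² + ρ Σ wᵢ² + B b²)`,
`A = θ(ζ0+ζ1)/ρ`, `B = 3ρ/(2θ)`. [folklore] -/
theorem shadow_fAudit_pointwise :
    ∀ (K C cZ : ℝ), 0 < K → 0 ≤ C → 0 ≤ cZ →
      ∃ Λ : ℝ, 0 ≤ Λ ∧
        ∀ (lam c₁ ρ θ ζ0 ζ1 ηh : ℝ) (du₁ : Fin 3 → Fin 3 → ℝ) (dc₁ : Fin 3 → ℝ)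
          (a b : ℝ) (w : Fin 3 → ℝ),
          0 < lam → 0 < c₁ → 0 ≤ ηh → ηh * (cZ + 1) ≤ 1 / 8 →
          |ζ0 - 1| ≤ cZ * ηh → |ζ1| ≤ cZ * ηh →
          |ρ - c₁ ^ 3| ≤ c₁ ^ 3 / 2 → |θ - K * c₁ ^ 2| ≤ K * c₁ ^ 2 / 2 →
          (∀ i j, |du₁ i j| ≤ C / lam) → (∀ i, |dc₁ i| ≤ C / lam) →
          θ * (ζ0 + ζ1) / ρ * a * (-(a * ∑ i, du₁ i i) - ∑ i, w i * (3 * c₁ ^ 2 * dc₁ i)) +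
            ρ * ∑ j, w j * (-(∑ i, w i * du₁ i j) - b * (ζ0 + ζ1) / ρ * (3 * c₁ ^ 2 * dc₁ j) +
              K * c₁ ^ 2 * a / (ρ * c₁ ^ 3) * (3 * c₁ ^ 2 * dc₁ j)) +
            3 / 2 * ρ / θ * b * (-(∑ i, w i * (2 * K * c₁ * dc₁ i)) - 2 / 3 * ζ0 * b * ∑ i, du₁ i i)
            ≤ Λ / lam *
              (1 / 2 * (θ * (ζ0 + ζ1) / ρ * a ^ 2 + ρ * ∑ i, w i ^ 2 + 3 / 2 * ρ / θ * b ^ 2)) := by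
  intro K C cZ hK hC _
  refine ⟨C * (95 + 78 * K), by positivity, ?_⟩
  intro lam c₁ ρ θ ζ0 ζ1 ηh du₁ dc₁ a b w hlam hc₁ hηh hηcZ hζ0 hζ1 hρ hθ hdu hdc
  simp only [Fin.sum_univ_three]
  have hsmall : cZ * ηh ≤ 1 / 8 := by linarith
  have hζ0' : |ζ0 - 1| ≤ 1 / 8 := hζ0.trans hsmall
  have hζ1' : |ζ1| ≤ 1 / 8 := hζ1.trans hsmall
  have hc3 : 0 < c₁ ^ 3 := by positivity
  have hKc : 0 < K * c₁ ^ 2 := by positivity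
  have hρpos : 0 < ρ := by linarith [(abs_le.1 hρ).1]
  have hρne : ρ ≠ 0 := hρpos.ne'
  have hc₁ne : c₁ ≠ 0 := hc₁.ne'
  have key := fa_main_bound K (C / lam) c₁ ρ θ ζ0 ζ1 a b (θ * (ζ0 + ζ1) / ρ) (3 / 2 * ρ / θ)
    (1 / 2 * (θ * (ζ0 + ζ1) / ρ * a ^ 2 + ρ * (w 0 ^ 2 + w 1 ^ 2 + w 2 ^ 2)
      + 3 / 2 * ρ / θ * b ^ 2))
    du₁ dc₁ w hK (by positivity) hc₁ hζ0' hζ1' hρ hθ hdu hdc rfl rfl rfl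
  have id1 : ρ * ((ζ0 + ζ1) / ρ) = ζ0 + ζ1 := by field_simp [hρne]
  have id2 : ρ * (K * c₁ ^ 2 * a / (ρ * c₁ ^ 3) * (3 * c₁ ^ 2)) = 3 * K * c₁ * a := by
    field_simp [hρne, hc₁ne]
  refine Eq.trans_le ?_ (key.trans_eq ?_)
  · linear_combination (-(3 * c₁ ^ 2 * b * (w 0 * dc₁ 0 + w 1 * dc₁ 1 + w 2 * dc₁ 2))) * id1
      + (w 0 * dc₁ 0 + w 1 * dc₁ 1 + w 2 * dc₁ 2) * id2
  · ring

end Summit.AtomisticToContinuum.HydrodynamicLimit.Theorems
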